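import Mathlib
import Summits.Ventures.PercRepro2.TypedDomainInstanceSep
import Summits.Ventures.PercRepro2.TypedBundleSepTwo

/-!
# The sixteen-condition domain is not empty: the separator-free 14-edge instance has neither an
`{a₃, b}`-pocket nor a (SEP-2) separator (blind cell PercRepro2, p2 g6, 2026-08-25; the lead's
R-SEP3(5) (iii))

On `ends14` (TypedDomainInstanceSep.lean) the edge `o–u` puts `u` on `o`'s side of any `{a₃, b}`-split
and `u–a₁` puts it on the roots' side (`noPocket14`); the edge `o–y` puts `y` on `o`'s side of any
root split and `y–b` on `b`'s side (`noSepTwoB14`, `noSepTwoO14`).  **`instance16_mem`**: the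
instance satisfies all sixteen conditions of `ResidualCoreNHatCTBRASUDO7SP2` (and
**`instance15_mem`** the fifteen of `ResidualCoreNHatCTBRASUDO7SP`).  Own code; standard axioms.
-/

namespace Summit.Ventures.PercRepro2

open UnionCluster

namespace CovForm

namespace TypedRed

namespace NonVacuity14

open Separated (zF)

/-- No `{a₃, b}`-pocket: `o–u` puts `u` on `o`'s side, `u–a₁` on the roots' side. -/
theorem noPocket14 : ¬ PocketAB.HasPocketAB ends14 0 1 2 3 4 F14 := by
  rintro ⟨WO, WB, hs⟩
  have hoB : (0 : Fin 9) ∉ WB := fun h => by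
    rcases hs.cap 0 hs.oO h with h3 | hb
    · exact absurd h3 (by decide)
    · exact absurd hb (by decide)
  have h1O : (1 : Fin 9) ∉ WO := fun h => by
    rcases hs.cap 1 h hs.a1B with h3 | hb
    · exact absurd h3 (by decide)
    · exact absurd hb (by decide)
  have huO : (5 : Fin 9) ∈ WO := by
    rcases hs.split 0 (zF14 0) with w | w
    · exact (ends_mem_of_within (x := 0) (y := 5) rfl w).2
    · exact absurd (ends_mem_of_within (x := 0) (y := 5) rfl w).1 hoB
  have huB : (5 : Fin 9) ∈ WB := by
    rcases hs.split 2 (zF14 2) with w | w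
    · exact absurd (ends_mem_of_within (x := 5) (y := 1) rfl w).2 h1O
    · exact (ends_mem_of_within (x := 5) (y := 1) rfl w).1
  rcases hs.cap 5 huO huB with h | h <;> exact absurd h (by decide)

/-- No (SEP-2) split with `a₃` on `b`'s side: `o–y` puts `y` on `o`'s side, `y–b` on `b`'s. -/
theorem noSepTwoB14 : ¬ SepTwo.HasSepTwoB ends14 0 1 2 3 4 F14 := by
  rintro ⟨WO, WB, hs⟩
  have hoB : (0 : Fin 9) ∉ WB := fun h => by
    rcases hs.cap 0 hs.oO h with h1 | h2
    · exact absurd h1 (by decide)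
    · exact absurd h2 (by decide)
  have hbO : (4 : Fin 9) ∉ WO := fun h => by
    rcases hs.cap 4 h hs.bB with h1 | h2
    · exact absurd h1 (by decide)
    · exact absurd h2 (by decide)
  have hyO : (7 : Fin 9) ∈ WO := by
    rcases hs.split 13 (zF14 13) with w | w
    · exact (ends_mem_of_within (x := 0) (y := 7) rfl w).2
    · exact absurd (ends_mem_of_within (x := 0) (y := 7) rfl w).1 hoB
  have hyB : (7 : Fin 9) ∈ WB := by
    rcases hs.split 9 (zF14 9) with w | w
    · exact absurd (ends_mem_of_within (x := 7) (y := 4) rfl w).2 hbO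
    · exact (ends_mem_of_within (x := 7) (y := 4) rfl w).1
  rcases hs.cap 7 hyO hyB with h | h <;> exact absurd h (by decide)

/-- No (SEP-2) split with `a₃` on `o`'s side: the same two edges. -/
theorem noSepTwoO14 : ¬ SepTwo.HasSepTwoO ends14 0 1 2 3 4 F14 := by
  rintro ⟨WO, WB, hs⟩
  have hoB : (0 : Fin 9) ∉ WB := fun h => by
    rcases hs.cap 0 hs.oO h with h1 | h2
    · exact absurd h1 (by decide)
    · exact absurd h2 (by decide)
  have hbO : (4 : Fin 9) ∉ WO := fun h => by
    rcases hs.cap 4 h hs.bB with h1 | h2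
    · exact absurd h1 (by decide)
    · exact absurd h2 (by decide)
  have hyO : (7 : Fin 9) ∈ WO := by
    rcases hs.split 13 (zF14 13) with w | w
    · exact (ends_mem_of_within (x := 0) (y := 7) rfl w).2
    · exact absurd (ends_mem_of_within (x := 0) (y := 7) rfl w).1 hoB
  have hyB : (7 : Fin 9) ∈ WB := by
    rcases hs.split 9 (zF14 9) with w | w
    · exact absurd (ends_mem_of_within (x := 7) (y := 4) rfl w).2 hbO
    · exact (ends_mem_of_within (x := 7) (y := 4) rfl w).1
  rcases hs.cap 7 hyO hyB with h | h <;> exact absurd h (by decide)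

/-- No (SEP-2) separator at all. -/
theorem noSepTwo14 : ¬ SepTwo.HasSepTwo ends14 0 1 2 3 4 F14 := fun h =>
  h.elim noSepTwoB14 noSepTwoO14

/-- **The fifteen-condition domain is not empty.** -/
theorem instance15_mem : ResidualCoreNHatCTBRASUDO7SP ends14 0 1 2 3 4 F14 :=
  ⟨instance14_mem, noPocket14⟩

/-- **The sixteen-condition domain is not empty.** -/
theorem instance16_mem : ResidualCoreNHatCTBRASUDO7SP2 ends14 0 1 2 3 4 F14 :=
  ⟨instance15_mem, noSepTwo14⟩

end NonVacuity14

end TypedRed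

end CovForm

end Summit.Ventures.PercRepro2
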